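import Mathlib
import HarnessLib
import Summits.HubbardSuperconductivity.HubbardSuperconductivity.Theorems.KLProgrammeKLRegimeEnginePairTransferMemberDefectDiffSmearing

/-!
# Route `KLProgramme` — ENGINE child gen 8 (stmt-HubbardSuperconductivity-20437 `KLRegimeEngineV17F2`), skeleton v2 class #5 rev 3: the CARRIER layer — the STEP's kernel inputs
# `M4 M6 M2` / `η4 η6 η2` (rows 38/40/41 of KLTC-INDEX v10) from ONE Gram constant of the running-symbol covariance + the pinned kernel norms of `𝒲^K_{Λ(t)}` itself —
# `klmd_sum_norm_kernel_gaussConv_le_binomial`, `klmd_vertexFn_gaussConv_le_binomial`, **`klmd_carrierNorms_le_binomial`**, **`klmd_kernel4_le_binomial`**,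
# **`klmd_kernel6_le_binomial`**, **`klmd_selfEnergy_le_binomial`**, **`klmd_kernelDiff4/6_le_binomial₂`**, **`klmd_selfEnergyDiff_le_binomial₂`**
# (cell gate-hubbard-kl, seat hubbard-kl-k3c1-p1 g14, technique «composed-map remainder propagation»: the smearing `e^{Δ_{S_Φ}}` propagated through the pins, two levels)

WHY.  The (X).3 producer in MASSES form (`pairTransferStep7_of_analytic_masses`, row 41) asks per pair `(j, j′)`, class `Qm` and time `t` for kernel sups `M4 M6 M2` of the
member CARRIERS `𝓜ᵢ(t) = e^{Δ_{S_{ψᵢ} + C_{>Λ_{n+1}} − C_{>Λ(t)}}}𝒲^K_{Λ(t)}` over ALL labels (the class sums evaluate the pins at shifted labels), and row 38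
(`klmd_kernelDiff4_le_binomial` & co.) asks for the pinned kernel norms `N(m′)` of the member-2 carrier.  The carrier's Wick covariance IS the covariance of the running
symbol `Φ_t = ψ + (w_{Λ_{n+1}} − w_{Λ(t)})` (`klmf_carrierCov_eq`: `S_ψ + C_{>Λ_{n+1}} − C_{>Λ(t)} = softCovOf K Φ_t`), and the Literature binomial–Gram bound at first order
(`sum_norm_kernel_gaussConv_le_binomial_of_gramBounded`, BGM 2006 (2.77)–(2.80): no row/column hypothesis, no factorial in the degree) controls every kernel of `e^{Δ_D}H` by a
Gram constant `κ` of `D` and the pinned norms of `H`.  Hence ALL six kernel inputs of the STEP and row 38's `hN` are functions of STANDARD objects: ONE Gram constant `κ` of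
`softCovOf K Φ_t` per member [Gram route] and the pinned kernel norms `N(m′)` of `𝒲^K_{Λ(t)} = hubbardEffectiveActionCT … K Λ(t)` along the continuum slice [class #1]:
* `klmd_sum_norm_kernel_gaussConv_le_binomial` / `klmd_vertexFn_gaussConv_le_binomial` — generic: `Σ_{Y : Y_i = w}‖kernel_{2m}(e^{Δ_D}H)(Y)‖ ≤ Σ_{m′ ≥ m} C(2m′,2m)κ^{2m′−2m}N(m′)` and
  the pointwise vertex-function form `‖𝒱_{2p}(e^{Δ_D}H)(X)‖ ≤ ((2p)!·|βL²|^{2p−1})·Σ_{m′ ≥ p} C(2m′,2p)κ^{2m′−2p}N(m′)` (`0 < p`);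
* **`klmd_carrierNorms_le_binomial`** — keyed on ONE member (`ψ`, frame `K`, slice `n+1`, time `t`, running symbol `Φ` pinned as in `klmd_pinnedDefect_eq_resolved`): the carrier's
  pinned kernel norms `Σ_{Y : Y_i = w}‖kernel_{2m}(𝓜(t))(Y)‖ ≤ N^car(m) := Σ_{m′ ≥ m} C(2m′,2m)κ^{2m′−2m}N(m′)` — literally the `hN` input of row 38 at `N := N^car`;
* **`klmd_kernel4_le_binomial`** / **`klmd_kernel6_le_binomial`** / **`klmd_selfEnergy_le_binomial`** — the pins `V V6 Sg` of row 31 at ALL labels: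
  `‖V t X‖ ≤ (4!·|βL²|³)·N^car(2)`, `‖V6 t X‖ ≤ (6!·|βL²|⁵)·N^car(3)`, `‖Sg t p σ‖ ≤ (2!·|βL²|)·N^car(1)` (the `M4 M6 M2` rows of rows 40/41, per member);
* **`klmd_kernelDiff4_le_binomial₂`** / **`klmd_kernelDiff6_le_binomial₂`** / **`klmd_selfEnergyDiff_le_binomial₂`** — row 38 composed with `klmd_carrierNorms_le_binomial` (TWO levels:
  `(e^{Δ_{S_D}} − 1)` then `e^{Δ_{S_{Φ₂}}}`): `‖V₁ t X − V₂ t X‖ ≤ (4!·|βL²|³)·Σ_{m′ > 2} C(2m′,4)κ_D^{2m′−4}N^car₂(m′)` with `N^car₂` the member-2 carrier profile from `κ₂` and `N`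
  — the `η4 η6 η2` rows from `κ_D` (Gram constant of the `D`-line `softCovOf K (ψ₁ − ψ₂)`), `κ₂` (of `softCovOf K Φ₂(t)`) and `N`.
Composition over landed lemmas; whether these Gram constants are affordable for deep members is the Gram route's call (the sectorised constants of …SectorSliceGram* are the
alternative supply of `M4 M6 M2`); nothing about the model's sizes is asserted; nothing asserts (X).3, (c), K3 or superconductivity.  0 kit · 0 lit.
-/

noncomputable section

namespace Summit.HubbardSuperconductivity.HubbardSuperconductivity.Theorems.KLRegimeSplit

set_option linter.dupNamespace false -- summit = problem name (single-conjunct summit), D-0017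

open Finset Matrix Set Literature.MathematicalPhysics.QuantumLattice Literature.Probability.LatticeModels GrassmannAlgebra
open Summit.HubbardSuperconductivity.HubbardSuperconductivity.Theorems.KLProgrammeLegKernels
open Summit.HubbardSuperconductivity.HubbardSuperconductivity.Theorems.TwoPointAssembly
open Summit.HubbardSuperconductivity.HubbardSuperconductivity.Theorems.DispersionFlow
open Summit.HubbardSuperconductivity.HubbardSuperconductivity.Theorems.KLRegimeWick
open Summit.HubbardSuperconductivity.HubbardSuperconductivity.Theorems.EngineV8

/-! ## §1 The binomial–Gram bound for `e^{Δ_D}H` itself: pinned sums and pointwise vertex functions -/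

section Generic

variable (L M : ℕ) [NeZero L] (β : ℝ)

/-- **Pinned kernel norms of `e^{Δ_D}H` in binomial–Gram form** (Literature `sum_norm_kernel_gaussConv_le_binomial_of_gramBounded` in an even degree `2m`, the degree
condition read as `m ≤ m′`): `Σ_{Y : Y_i = w}‖kernel_{2m}(e^{Δ_D}H)(Y)‖ ≤ Σ_{m′} [m ≤ m′]·C(2m′,2m)·κ^{2m′−2m}·N(m′)`. -/
theorem klmd_sum_norm_kernel_gaussConv_le_binomial {D : Matrix (HubbardFieldIdx L M) (HubbardFieldIdx L M) ℂ} {κ : ℝ} (hκ : 0 ≤ κ)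
    (hGB : IsGramBoundedR D κ) (H : HubbardGrassmann L M) (hH : H ∈ evenPart ℂ (HubbardFieldIdx L M)) (N : ℕ → ℝ) (hN0 : ∀ m', 0 ≤ N m')
    (hN : ∀ m' (j : Fin (2 * m')) (w : HubbardFieldIdx L M),
      ∑ Y ∈ univ.filter (fun Y : Fin (2 * m') → HubbardFieldIdx L M => Y j = w), ‖kernel ℂ H (2 * m') Y‖ ≤ N m')
    (m : ℕ) (i : Fin (2 * m)) (w : HubbardFieldIdx L M) :
    ∑ Y ∈ univ.filter (fun Y : Fin (2 * m) → HubbardFieldIdx L M => Y i = w), ‖kernel ℂ (gaussConv ℂ D H) (2 * m) Y‖ ≤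
      ∑ m' ∈ range (Fintype.card (HubbardFieldIdx L M) / 2 + 1), if m ≤ m' then ((2 * m').choose (2 * m) : ℝ) * κ ^ (2 * m' - 2 * m) * N m' else 0 := by
  refine (sum_norm_kernel_gaussConv_le_binomial_of_gramBounded (𝕜 := ℂ) D hκ hGB H hH N hN0 hN (r := 2 * m) i w).trans (le_of_eq ?_)
  refine sum_congr rfl fun m' _ => ?_
  by_cases h : m ≤ m'
  · rw [if_pos (by omega), if_pos h]
  · rw [if_neg (by omega), if_neg h]

/-- **Pointwise vertex-function form** (`0 < p`): `‖𝒱_{2p}(e^{Δ_D}H)(X)‖ ≤ ((2p)!·|βL²|^{2p−1})·Σ_{m′} [p ≤ m′]·C(2m′,2p)·κ^{2m′−2p}·N(m′)`. -/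
theorem klmd_vertexFn_gaussConv_le_binomial {D : Matrix (HubbardFieldIdx L M) (HubbardFieldIdx L M) ℂ} {κ : ℝ} (hκ : 0 ≤ κ)
    (hGB : IsGramBoundedR D κ) (H : HubbardGrassmann L M) (hH : H ∈ evenPart ℂ (HubbardFieldIdx L M)) (N : ℕ → ℝ) (hN0 : ∀ m', 0 ≤ N m')
    (hN : ∀ m' (j : Fin (2 * m')) (w : HubbardFieldIdx L M),
      ∑ Y ∈ univ.filter (fun Y : Fin (2 * m') → HubbardFieldIdx L M => Y j = w), ‖kernel ℂ H (2 * m') Y‖ ≤ N m')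
    {p : ℕ} (hp : 0 < p) (X : Fin (2 * p) → HubbardFieldIdx L M) :
    ‖vertexFn L M β (gaussConv ℂ D H) (2 * p) X‖ ≤
      (((2 * p).factorial : ℝ) * |β * (L : ℝ) ^ 2| ^ (2 * p - 1)) *
        ∑ m' ∈ range (Fintype.card (HubbardFieldIdx L M) / 2 + 1), if p ≤ m' then ((2 * m').choose (2 * p) : ℝ) * κ ^ (2 * m' - 2 * p) * N m' else 0 := by
  have h0 : 0 < 2 * p := by omega
  have hsum := klmd_sum_norm_kernel_gaussConv_le_binomial L M hκ hGB H hH N hN0 hN p (⟨0, h0⟩ : Fin (2 * p)) (X ⟨0, h0⟩)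
  have hsingle : ‖kernel ℂ (gaussConv ℂ D H) (2 * p) X‖ ≤
      ∑ W ∈ univ.filter (fun W : Fin (2 * p) → HubbardFieldIdx L M => W ⟨0, h0⟩ = X ⟨0, h0⟩), ‖kernel ℂ (gaussConv ℂ D H) (2 * p) W‖ :=
    single_le_sum (f := fun W => ‖kernel ℂ (gaussConv ℂ D H) (2 * p) W‖) (fun W _ => norm_nonneg _) (by simp)
  rw [vertexFn_def, norm_mul, Complex.norm_real, Real.norm_eq_abs, abs_mul, abs_pow, Nat.abs_cast]
  exact mul_le_mul_of_nonneg_left (hsingle.trans hsum) (by positivity)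

end Generic

/-! ## §2 Keyed on ONE member: the carrier's pinned norms and the pins `V V6 Sg` at all labels -/

section Member

variable (L M : ℕ) [NeZero L] (β U μ : ℝ) (K : TrigPolyC4v)

/-- The carrier covariance is the running symbol's covariance, keyed on the `Φ` pin of `klmd_pinnedDefect_eq_resolved`. -/
theorem klmd_carrierCov_eq_softCovOf_pin (n : ℕ) (ψ : FreqMomentum L M → ℝ)
    (Φ : ℝ → FreqMomentum L M → ℝ) (hΦ : Φ = fun t k => ψ k + (hubbardCutoffWeightCT L M β μ K (klScale klE0 (n + 1)) k - hubbardCutoffWeightCT L M β μ K (klScale klE0 n + t * (klScale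
            klE0 (n + 1) - klScale klE0 n)) k)) (t : ℝ) :
    softCovOf L M β μ K ψ + hubbardCovAboveCT L M β μ 0 K (klScale klE0 (n + 1)) -
        hubbardCovAboveCT L M β μ 0 K (klScale klE0 n + t * (klScale klE0 (n + 1) - klScale klE0 n)) = softCovOf L M β μ K (Φ t) := by
  rw [hΦ, klmf_carrierCov_eq]

/-- **`klmd_carrierNorms_le_binomial`** — the member carrier's pinned kernel norms from ONE Gram constant `κ` of `softCovOf K Φ_t` and the pinned norms `N` of `𝒲^K_{Λ(t)}`:
`Σ_{Y : Y_i = w}‖kernel_{2m}(e^{Δ_{S_ψ + C_{>Λ_{n+1}} − C_{>Λ(t)}}}𝒲^K_{Λ(t)})(Y)‖ ≤ Σ_{m′} [m ≤ m′]·C(2m′,2m)·κ^{2m′−2m}·N(m′)` — the `hN` input of row 38 (`klmd_kernelDiff4_le_binomial` & co.). -/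
theorem klmd_carrierNorms_le_binomial (n : ℕ) (ψ : FreqMomentum L M → ℝ)
    (Φ : ℝ → FreqMomentum L M → ℝ) (hΦ : Φ = fun t k => ψ k + (hubbardCutoffWeightCT L M β μ K (klScale klE0 (n + 1)) k - hubbardCutoffWeightCT L M β μ K (klScale klE0 n + t * (klScale
            klE0 (n + 1) - klScale klE0 n)) k)) (t : ℝ)
    {κ : ℝ} (hκ : 0 ≤ κ) (hGB : IsGramBoundedR (softCovOf L M β μ K (Φ t)) κ)
    (N : ℕ → ℝ) (hN0 : ∀ m', 0 ≤ N m')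
    (hN : ∀ m' (i : Fin (2 * m')) (w : HubbardFieldIdx L M),
      ∑ Y ∈ univ.filter (fun Y : Fin (2 * m') → HubbardFieldIdx L M => Y i = w),
        ‖kernel ℂ (hubbardEffectiveActionCT L M β U μ 0 K (klScale klE0 n + t * (klScale klE0 (n + 1) - klScale klE0 n))) (2 * m') Y‖ ≤ N m')
    (m : ℕ) (i : Fin (2 * m)) (w : HubbardFieldIdx L M) :
    ∑ Y ∈ univ.filter (fun Y : Fin (2 * m) → HubbardFieldIdx L M => Y i = w),
        ‖kernel ℂ (gaussConv ℂ (softCovOf L M β μ K ψ + hubbardCovAboveCT L M β μ 0 K (klScale klE0 (n + 1)) -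
            hubbardCovAboveCT L M β μ 0 K (klScale klE0 n + t * (klScale klE0 (n + 1) - klScale klE0 n)))
          (hubbardEffectiveActionCT L M β U μ 0 K (klScale klE0 n + t * (klScale klE0 (n + 1) - klScale klE0 n)))) (2 * m) Y‖ ≤
      ∑ m' ∈ range (Fintype.card (HubbardFieldIdx L M) / 2 + 1), if m ≤ m' then ((2 * m').choose (2 * m) : ℝ) * κ ^ (2 * m' - 2 * m) * N m' else 0 := by
  rw [klmd_carrierCov_eq_softCovOf_pin L M β μ K n ψ Φ hΦ t]
  exact klmd_sum_norm_kernel_gaussConv_le_binomial L M hκ hGB _ ((mem_evenPart_iff).2 (klws_effectiveActionR_mem_evenOdd_zero β U μ K _)) N hN0 hN m i w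

/-- **`klmd_kernel4_le_binomial`** — the 4-point pin `V` of `klmd_pinnedDefect_eq_resolved` at ALL labels (the `M4` row of rows 40/41, this member):
`‖V t X‖ ≤ (4!·|βL²|³)·Σ_{m′} [2 ≤ m′]·C(2m′,4)·κ^{2m′−4}·N(m′)`. -/
theorem klmd_kernel4_le_binomial (n : ℕ) (ψ : FreqMomentum L M → ℝ)
    (V : ℝ → (Fin 4 → HubbardFieldIdx L M) → ℂ) (hV : V = fun t X => vertexFn L M β (gaussConv ℂ (softCovOf L M β μ K ψ + hubbardCovAboveCT L M β μ 0 K (klScale klE0 (n + 1)) -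
            hubbardCovAboveCT L M β μ 0 K (klScale klE0 n + t * (klScale klE0 (n + 1) - klScale klE0 n))) (hubbardEffectiveActionCT L M β U μ 0 K (klScale klE0 n + t * (klScale klE0 (n
            + 1) - klScale klE0 n)))) 4 X)
    (Φ : ℝ → FreqMomentum L M → ℝ) (hΦ : Φ = fun t k => ψ k + (hubbardCutoffWeightCT L M β μ K (klScale klE0 (n + 1)) k - hubbardCutoffWeightCT L M β μ K (klScale klE0 n + t * (klScale
            klE0 (n + 1) - klScale klE0 n)) k)) (t : ℝ)
    {κ : ℝ} (hκ : 0 ≤ κ) (hGB : IsGramBoundedR (softCovOf L M β μ K (Φ t)) κ)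
    (N : ℕ → ℝ) (hN0 : ∀ m', 0 ≤ N m')
    (hN : ∀ m' (i : Fin (2 * m')) (w : HubbardFieldIdx L M),
      ∑ Y ∈ univ.filter (fun Y : Fin (2 * m') → HubbardFieldIdx L M => Y i = w),
        ‖kernel ℂ (hubbardEffectiveActionCT L M β U μ 0 K (klScale klE0 n + t * (klScale klE0 (n + 1) - klScale klE0 n))) (2 * m') Y‖ ≤ N m')
    (X : Fin 4 → HubbardFieldIdx L M) :
    ‖V t X‖ ≤
      (((2 * 2).factorial : ℝ) * |β * (L : ℝ) ^ 2| ^ (2 * 2 - 1)) *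
        ∑ m' ∈ range (Fintype.card (HubbardFieldIdx L M) / 2 + 1), if 2 ≤ m' then ((2 * m').choose (2 * 2) : ℝ) * κ ^ (2 * m' - 2 * 2) * N m' else 0 := by
  subst hV
  dsimp only
  rw [klmd_carrierCov_eq_softCovOf_pin L M β μ K n ψ Φ hΦ t]
  exact klmd_vertexFn_gaussConv_le_binomial L M β hκ hGB _ ((mem_evenPart_iff).2 (klws_effectiveActionR_mem_evenOdd_zero β U μ K _)) N hN0 hN
    (p := 2) (by norm_num) X

/-- **`klmd_kernel6_le_binomial`** — the same for the 6-point pin `V6` (the `M6` row): `‖V6 t X‖ ≤ (6!·|βL²|⁵)·Σ_{m′} [3 ≤ m′]·C(2m′,6)·κ^{2m′−6}·N(m′)`. -/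
theorem klmd_kernel6_le_binomial (n : ℕ) (ψ : FreqMomentum L M → ℝ)
    (V6 : ℝ → (Fin 6 → HubbardFieldIdx L M) → ℂ) (hV6 : V6 = fun t X => vertexFn L M β (gaussConv ℂ (softCovOf L M β μ K ψ + hubbardCovAboveCT L M β μ 0 K (klScale klE0 (n + 1)) -
            hubbardCovAboveCT L M β μ 0 K (klScale klE0 n + t * (klScale klE0 (n + 1) - klScale klE0 n))) (hubbardEffectiveActionCT L M β U μ 0 K (klScale klE0 n + t * (klScale klE0 (n
            + 1) - klScale klE0 n)))) 6 X)
    (Φ : ℝ → FreqMomentum L M → ℝ) (hΦ : Φ = fun t k => ψ k + (hubbardCutoffWeightCT L M β μ K (klScale klE0 (n + 1)) k - hubbardCutoffWeightCT L M β μ K (klScale klE0 n + t * (klScale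
            klE0 (n + 1) - klScale klE0 n)) k)) (t : ℝ)
    {κ : ℝ} (hκ : 0 ≤ κ) (hGB : IsGramBoundedR (softCovOf L M β μ K (Φ t)) κ)
    (N : ℕ → ℝ) (hN0 : ∀ m', 0 ≤ N m')
    (hN : ∀ m' (i : Fin (2 * m')) (w : HubbardFieldIdx L M),
      ∑ Y ∈ univ.filter (fun Y : Fin (2 * m') → HubbardFieldIdx L M => Y i = w),
        ‖kernel ℂ (hubbardEffectiveActionCT L M β U μ 0 K (klScale klE0 n + t * (klScale klE0 (n + 1) - klScale klE0 n))) (2 * m') Y‖ ≤ N m')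
    (X : Fin 6 → HubbardFieldIdx L M) :
    ‖V6 t X‖ ≤
      (((2 * 3).factorial : ℝ) * |β * (L : ℝ) ^ 2| ^ (2 * 3 - 1)) *
        ∑ m' ∈ range (Fintype.card (HubbardFieldIdx L M) / 2 + 1), if 3 ≤ m' then ((2 * m').choose (2 * 3) : ℝ) * κ ^ (2 * m' - 2 * 3) * N m' else 0 := by
  subst hV6
  dsimp only
  rw [klmd_carrierCov_eq_softCovOf_pin L M β μ K n ψ Φ hΦ t]
  exact klmd_vertexFn_gaussConv_le_binomial L M β hκ hGB _ ((mem_evenPart_iff).2 (klws_effectiveActionR_mem_evenOdd_zero β U μ K _)) N hN0 hN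
    (p := 3) (by norm_num) X

/-- **`klmd_selfEnergy_le_binomial`** — the same for the self-energy pin `Sg` (the `M2` row): `‖Sg t p σ‖ ≤ (2!·|βL²|)·Σ_{m′} [1 ≤ m′]·C(2m′,2)·κ^{2m′−2}·N(m′)`. -/
theorem klmd_selfEnergy_le_binomial (n : ℕ) (ψ : FreqMomentum L M → ℝ)
    (Sg : ℝ → FreqMomentum L M → Fin 2 → ℂ) (hSg : Sg = fun t p σ => selfEnergy L M β (gaussConv ℂ (softCovOf L M β μ K ψ + hubbardCovAboveCT L M β μ 0 K (klScale klE0 (n + 1)) -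
            hubbardCovAboveCT L M β μ 0 K (klScale klE0 n + t * (klScale klE0 (n + 1) - klScale klE0 n))) (hubbardEffectiveActionCT L M β U μ 0 K (klScale klE0 n + t * (klScale klE0 (n
            + 1) - klScale klE0 n)))) p σ)
    (Φ : ℝ → FreqMomentum L M → ℝ) (hΦ : Φ = fun t k => ψ k + (hubbardCutoffWeightCT L M β μ K (klScale klE0 (n + 1)) k - hubbardCutoffWeightCT L M β μ K (klScale klE0 n + t * (klScale
            klE0 (n + 1) - klScale klE0 n)) k)) (t : ℝ)
    {κ : ℝ} (hκ : 0 ≤ κ) (hGB : IsGramBoundedR (softCovOf L M β μ K (Φ t)) κ)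
    (N : ℕ → ℝ) (hN0 : ∀ m', 0 ≤ N m')
    (hN : ∀ m' (i : Fin (2 * m')) (w : HubbardFieldIdx L M),
      ∑ Y ∈ univ.filter (fun Y : Fin (2 * m') → HubbardFieldIdx L M => Y i = w),
        ‖kernel ℂ (hubbardEffectiveActionCT L M β U μ 0 K (klScale klE0 n + t * (klScale klE0 (n + 1) - klScale klE0 n))) (2 * m') Y‖ ≤ N m')
    (p : FreqMomentum L M) (σ : Fin 2) :
    ‖Sg t p σ‖ ≤
      (((2 * 1).factorial : ℝ) * |β * (L : ℝ) ^ 2| ^ (2 * 1 - 1)) *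
        ∑ m' ∈ range (Fintype.card (HubbardFieldIdx L M) / 2 + 1), if 1 ≤ m' then ((2 * m').choose (2 * 1) : ℝ) * κ ^ (2 * m' - 2 * 1) * N m' else 0 := by
  subst hSg
  dsimp only
  rw [selfEnergy, klmd_carrierCov_eq_softCovOf_pin L M β μ K n ψ Φ hΦ t]
  exact klmd_vertexFn_gaussConv_le_binomial L M β hκ hGB _ ((mem_evenPart_iff).2 (klws_effectiveActionR_mem_evenOdd_zero β U μ K _)) N hN0 hN
    (p := 1) (by norm_num) _

end Member

/-! ## §3 Two levels: row 38's kernel DIFFERENCES from `κ_D`, the member-2 Gram constant `κ₂` and the pinned norms of `𝒲^K_{Λ(t)}` -/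

section Pair

variable (L M : ℕ) [NeZero L] (β U μ : ℝ) (K : TrigPolyC4v)

/-- The binomial carrier profile is nonnegative termwise. -/
theorem klmd_binomialProfile_nonneg {κ : ℝ} (hκ : 0 ≤ κ) (N : ℕ → ℝ) (hN0 : ∀ m', 0 ≤ N m') (card m : ℕ) :
    0 ≤ ∑ m' ∈ range card, if m ≤ m' then ((2 * m').choose (2 * m) : ℝ) * κ ^ (2 * m' - 2 * m) * N m' else 0 :=
  sum_nonneg fun m' _ => by
    split_ifs
    · exact mul_nonneg (mul_nonneg (Nat.cast_nonneg _) (pow_nonneg hκ _)) (hN0 m')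
    · exact le_rfl

/-- **`klmd_kernelDiff4_le_binomial₂`** — row 38's `klmd_kernelDiff4_le_binomial` with its `hN` input DISCHARGED by `klmd_carrierNorms_le_binomial` on member 2: from the Gram
constant `κD` of the `D`-line `softCovOf K (ψ₁ − ψ₂)`, the Gram constant `κ₂` of member 2's running-symbol covariance `softCovOf K Φ₂(t)` and the pinned norms `N` of `𝒲^K_{Λ(t)}`:
`‖V₁ t X − V₂ t X‖ ≤ (4!·|βL²|³)·Σ_{m′} [2 < m′]·C(2m′,4)·κD^{2m′−4}·N^car₂(m′)`, `N^car₂(m′) = Σ_{m″} [m′ ≤ m″]·C(2m″,2m′)·κ₂^{2m″−2m′}·N(m″)`. -/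
theorem klmd_kernelDiff4_le_binomial₂ (n : ℕ) (ψ₁ ψ₂ : FreqMomentum L M → ℝ)
    (V₁ : ℝ → (Fin 4 → HubbardFieldIdx L M) → ℂ) (hV₁ : V₁ = fun t X => vertexFn L M β (gaussConv ℂ (softCovOf L M β μ K ψ₁ + hubbardCovAboveCT L M β μ 0 K (klScale klE0 (n + 1)) -
            hubbardCovAboveCT L M β μ 0 K (klScale klE0 n + t * (klScale klE0 (n + 1) - klScale klE0 n))) (hubbardEffectiveActionCT L M β U μ 0 K (klScale klE0 n + t * (klScale klE0 (n
            + 1) - klScale klE0 n)))) 4 X)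
    (V₂ : ℝ → (Fin 4 → HubbardFieldIdx L M) → ℂ) (hV₂ : V₂ = fun t X => vertexFn L M β (gaussConv ℂ (softCovOf L M β μ K ψ₂ + hubbardCovAboveCT L M β μ 0 K (klScale klE0 (n + 1)) -
            hubbardCovAboveCT L M β μ 0 K (klScale klE0 n + t * (klScale klE0 (n + 1) - klScale klE0 n))) (hubbardEffectiveActionCT L M β U μ 0 K (klScale klE0 n + t * (klScale klE0 (n
            + 1) - klScale klE0 n)))) 4 X)
    (Φ₂ : ℝ → FreqMomentum L M → ℝ) (hΦ₂ : Φ₂ = fun t k => ψ₂ k + (hubbardCutoffWeightCT L M β μ K (klScale klE0 (n + 1)) k - hubbardCutoffWeightCT L M β μ K (klScale klE0 n + t *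
            (klScale klE0 (n + 1) - klScale klE0 n)) k))
    {κD : ℝ} (hκD : 0 ≤ κD) (hGBD : IsGramBoundedR (softCovOf L M β μ K (ψ₁ - ψ₂)) κD) (t : ℝ)
    {κ₂ : ℝ} (hκ₂ : 0 ≤ κ₂) (hGB₂ : IsGramBoundedR (softCovOf L M β μ K (Φ₂ t)) κ₂)
    (N : ℕ → ℝ) (hN0 : ∀ m', 0 ≤ N m')
    (hN : ∀ m' (i : Fin (2 * m')) (w : HubbardFieldIdx L M),
      ∑ Y ∈ univ.filter (fun Y : Fin (2 * m') → HubbardFieldIdx L M => Y i = w),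
        ‖kernel ℂ (hubbardEffectiveActionCT L M β U μ 0 K (klScale klE0 n + t * (klScale klE0 (n + 1) - klScale klE0 n))) (2 * m') Y‖ ≤ N m')
    (X : Fin 4 → HubbardFieldIdx L M) :
    ‖V₁ t X - V₂ t X‖ ≤
      (((2 * 2).factorial : ℝ) * |β * (L : ℝ) ^ 2| ^ (2 * 2 - 1)) *
        ∑ m' ∈ range (Fintype.card (HubbardFieldIdx L M) / 2 + 1), if 2 < m' then ((2 * m').choose (2 * 2) : ℝ) * κD ^ (2 * m' - 2 * 2) *
          (∑ m'' ∈ range (Fintype.card (HubbardFieldIdx L M) / 2 + 1), if m' ≤ m'' then ((2 * m'').choose (2 * m') : ℝ) * κ₂ ^ (2 * m'' - 2 * m') * N m'' else 0) else 0 :=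
  klmd_kernelDiff4_le_binomial L M β U μ K n ψ₁ ψ₂ V₁ hV₁ V₂ hV₂ hκD hGBD t _
    (fun m' => klmd_binomialProfile_nonneg hκ₂ N hN0 _ m')
    (fun m' i w => klmd_carrierNorms_le_binomial L M β U μ K n ψ₂ Φ₂ hΦ₂ t hκ₂ hGB₂ N hN0 hN m' i w) X

/-- **`klmd_kernelDiff6_le_binomial₂`** — the same for the 6-point pins: `‖V6₁ t X − V6₂ t X‖ ≤ (6!·|βL²|⁵)·Σ_{m′} [3 < m′]·C(2m′,6)·κD^{2m′−6}·N^car₂(m′)`. -/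
theorem klmd_kernelDiff6_le_binomial₂ (n : ℕ) (ψ₁ ψ₂ : FreqMomentum L M → ℝ)
    (V6₁ : ℝ → (Fin 6 → HubbardFieldIdx L M) → ℂ) (hV6₁ : V6₁ = fun t X => vertexFn L M β (gaussConv ℂ (softCovOf L M β μ K ψ₁ + hubbardCovAboveCT L M β μ 0 K (klScale klE0 (n + 1)) -
            hubbardCovAboveCT L M β μ 0 K (klScale klE0 n + t * (klScale klE0 (n + 1) - klScale klE0 n))) (hubbardEffectiveActionCT L M β U μ 0 K (klScale klE0 n + t * (klScale klE0 (n
            + 1) - klScale klE0 n)))) 6 X)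
    (V6₂ : ℝ → (Fin 6 → HubbardFieldIdx L M) → ℂ) (hV6₂ : V6₂ = fun t X => vertexFn L M β (gaussConv ℂ (softCovOf L M β μ K ψ₂ + hubbardCovAboveCT L M β μ 0 K (klScale klE0 (n + 1)) -
            hubbardCovAboveCT L M β μ 0 K (klScale klE0 n + t * (klScale klE0 (n + 1) - klScale klE0 n))) (hubbardEffectiveActionCT L M β U μ 0 K (klScale klE0 n + t * (klScale klE0 (n
            + 1) - klScale klE0 n)))) 6 X)
    (Φ₂ : ℝ → FreqMomentum L M → ℝ) (hΦ₂ : Φ₂ = fun t k => ψ₂ k + (hubbardCutoffWeightCT L M β μ K (klScale klE0 (n + 1)) k - hubbardCutoffWeightCT L M β μ K (klScale klE0 n + t *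
            (klScale klE0 (n + 1) - klScale klE0 n)) k))
    {κD : ℝ} (hκD : 0 ≤ κD) (hGBD : IsGramBoundedR (softCovOf L M β μ K (ψ₁ - ψ₂)) κD) (t : ℝ)
    {κ₂ : ℝ} (hκ₂ : 0 ≤ κ₂) (hGB₂ : IsGramBoundedR (softCovOf L M β μ K (Φ₂ t)) κ₂)
    (N : ℕ → ℝ) (hN0 : ∀ m', 0 ≤ N m')
    (hN : ∀ m' (i : Fin (2 * m')) (w : HubbardFieldIdx L M),
      ∑ Y ∈ univ.filter (fun Y : Fin (2 * m') → HubbardFieldIdx L M => Y i = w),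
        ‖kernel ℂ (hubbardEffectiveActionCT L M β U μ 0 K (klScale klE0 n + t * (klScale klE0 (n + 1) - klScale klE0 n))) (2 * m') Y‖ ≤ N m')
    (X : Fin 6 → HubbardFieldIdx L M) :
    ‖V6₁ t X - V6₂ t X‖ ≤
      (((2 * 3).factorial : ℝ) * |β * (L : ℝ) ^ 2| ^ (2 * 3 - 1)) *
        ∑ m' ∈ range (Fintype.card (HubbardFieldIdx L M) / 2 + 1), if 3 < m' then ((2 * m').choose (2 * 3) : ℝ) * κD ^ (2 * m' - 2 * 3) *
          (∑ m'' ∈ range (Fintype.card (HubbardFieldIdx L M) / 2 + 1), if m' ≤ m'' then ((2 * m'').choose (2 * m') : ℝ) * κ₂ ^ (2 * m'' - 2 * m') * N m'' else 0) else 0 :=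
  klmd_kernelDiff6_le_binomial L M β U μ K n ψ₁ ψ₂ V6₁ hV6₁ V6₂ hV6₂ hκD hGBD t _
    (fun m' => klmd_binomialProfile_nonneg hκ₂ N hN0 _ m')
    (fun m' i w => klmd_carrierNorms_le_binomial L M β U μ K n ψ₂ Φ₂ hΦ₂ t hκ₂ hGB₂ N hN0 hN m' i w) X

/-- **`klmd_selfEnergyDiff_le_binomial₂`** — the same for the self-energy pins: `‖Sg₁ t p σ − Sg₂ t p σ‖ ≤ (2!·|βL²|)·Σ_{m′} [1 < m′]·C(2m′,2)·κD^{2m′−2}·N^car₂(m′)`. -/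
theorem klmd_selfEnergyDiff_le_binomial₂ (n : ℕ) (ψ₁ ψ₂ : FreqMomentum L M → ℝ)
    (Sg₁ : ℝ → FreqMomentum L M → Fin 2 → ℂ) (hSg₁ : Sg₁ = fun t p σ => selfEnergy L M β (gaussConv ℂ (softCovOf L M β μ K ψ₁ + hubbardCovAboveCT L M β μ 0 K (klScale klE0 (n + 1)) -
            hubbardCovAboveCT L M β μ 0 K (klScale klE0 n + t * (klScale klE0 (n + 1) - klScale klE0 n))) (hubbardEffectiveActionCT L M β U μ 0 K (klScale klE0 n + t * (klScale klE0 (n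
            + 1) - klScale klE0 n)))) p σ)
    (Sg₂ : ℝ → FreqMomentum L M → Fin 2 → ℂ) (hSg₂ : Sg₂ = fun t p σ => selfEnergy L M β (gaussConv ℂ (softCovOf L M β μ K ψ₂ + hubbardCovAboveCT L M β μ 0 K (klScale klE0 (n + 1)) -
            hubbardCovAboveCT L M β μ 0 K (klScale klE0 n + t * (klScale klE0 (n + 1) - klScale klE0 n))) (hubbardEffectiveActionCT L M β U μ 0 K (klScale klE0 n + t * (klScale klE0 (n
            + 1) - klScale klE0 n)))) p σ)
    (Φ₂ : ℝ → FreqMomentum L M → ℝ) (hΦ₂ : Φ₂ = fun t k => ψ₂ k + (hubbardCutoffWeightCT L M β μ K (klScale klE0 (n + 1)) k - hubbardCutoffWeightCT L M β μ K (klScale klE0 n + t *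
            (klScale klE0 (n + 1) - klScale klE0 n)) k))
    {κD : ℝ} (hκD : 0 ≤ κD) (hGBD : IsGramBoundedR (softCovOf L M β μ K (ψ₁ - ψ₂)) κD) (t : ℝ)
    {κ₂ : ℝ} (hκ₂ : 0 ≤ κ₂) (hGB₂ : IsGramBoundedR (softCovOf L M β μ K (Φ₂ t)) κ₂)
    (N : ℕ → ℝ) (hN0 : ∀ m', 0 ≤ N m')
    (hN : ∀ m' (i : Fin (2 * m')) (w : HubbardFieldIdx L M),
      ∑ Y ∈ univ.filter (fun Y : Fin (2 * m') → HubbardFieldIdx L M => Y i = w),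
        ‖kernel ℂ (hubbardEffectiveActionCT L M β U μ 0 K (klScale klE0 n + t * (klScale klE0 (n + 1) - klScale klE0 n))) (2 * m') Y‖ ≤ N m')
    (p : FreqMomentum L M) (σ : Fin 2) :
    ‖Sg₁ t p σ - Sg₂ t p σ‖ ≤
      (((2 * 1).factorial : ℝ) * |β * (L : ℝ) ^ 2| ^ (2 * 1 - 1)) *
        ∑ m' ∈ range (Fintype.card (HubbardFieldIdx L M) / 2 + 1), if 1 < m' then ((2 * m').choose (2 * 1) : ℝ) * κD ^ (2 * m' - 2 * 1) *
          (∑ m'' ∈ range (Fintype.card (HubbardFieldIdx L M) / 2 + 1), if m' ≤ m'' then ((2 * m'').choose (2 * m') : ℝ) * κ₂ ^ (2 * m'' - 2 * m') * N m'' else 0) else 0 :=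
  klmd_selfEnergyDiff_le_binomial L M β U μ K n ψ₁ ψ₂ Sg₁ hSg₁ Sg₂ hSg₂ hκD hGBD t _
    (fun m' => klmd_binomialProfile_nonneg hκ₂ N hN0 _ m')
    (fun m' i w => klmd_carrierNorms_le_binomial L M β U μ K n ψ₂ Φ₂ hΦ₂ t hκ₂ hGB₂ N hN0 hN m' i w) p σ

end Pair

end Summit.HubbardSuperconductivity.HubbardSuperconductivity.Theorems.KLRegimeSplit

end
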